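import Summits.CriticalPhenomena.PercolationContinuityZ3.Theorems.PercNearOneGluingNoHeavyLowerTailSahiTangentLayerProduct
import HarnessLib

/-!
# `NoHeavyLowerTail` (crux stmt-CriticalPhenomena-4575), Sahi programme: **THE LAW OF TOTAL `E_n` IN THE `(E¹, E⁰)` BASIS AND
# THE ADDITIVITY OF SAHI'S `E_n` IN THE WEIGHT — for ANY layer weights `μ¹, μ⁰` on `α` and ANY pair family `F_l = (ε ? g¹_l : g⁰_l)`
# on `Bool × α`:  `E_n^{ν}(F) = E_n^{μ¹}(g¹) + E_n^{μ⁰}(g⁰) − Σ_{∅≠S⊊[n]} E_{|S|}^{μ¹}(g¹|_S)·E_{|Sᶜ|}^{μ⁰}(g⁰|_{Sᶜ})`;  hence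
# `E_n^{μ+ν}(f) = E_n^{μ}(f) + E_n^{ν}(f) − Σ_{∅≠S⊊[n]} E^{μ}(f|_S)·E^{ν}(f|_{Sᶜ})`** (all orders, any real weights, any functions)

Support file (Sahi cell, seat `prim-sahi-p1`, generation 52; `--supports stmt-CriticalPhenomena-4575`); part 2 of 2 (part 1:
`…SahiTangentLayerProduct`, the product formula for split families).  Pure proofs, NO definitions, no `sorry`, standard axioms.
Vocabulary: `sahiE`, `ex`; sub-families are written, as in `…SahiMomentExpansion`, `sahiE μ S.card (fun j => g (S.orderEmbOfFin rfl j))`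
(increasing enumeration of `S : Finset (Fin n)`); the two-layer weight on `Bool × α` with layers `μ¹` (top, `ε = true`) and `μ⁰`
(bottom) is `fun z => if z.1 then μ¹ z.2 else μ⁰ z.2` — for `μ¹ = s·μ`, `μ⁰ = (1−s)·μ` the coin product `B_s ⊗ μ` of the
`…SahiTangent*` files; for a probability weight `ν` on `Bool × α`, `μ^b = ν(layer b)·ν(· | layer b)`.

THE MATHEMATICS (mechanism = multiplicativity of `1 − G_μ(F) = Π_x (1 − F(x))^{μ(x)}` over the two layers / additivity of `log(1 − G)` in the weight
[Sahi2008, eq. (3), (14)]).  PLACEMENT (added after landing; the declarations below are unchanged): these identities are the TWO-POINT OUTER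
FACTOR of the cell's LAW OF TOTAL CUMULANCE `SahiTotalCumulance.sahiE_prod_eq_sum_partition` (`SahiMasterFamilyTotalCumulance.lean`, prim-masterthm
P4: `E^{μ⊗ν}_{n+1}(f) = Σ_π E^{ν}_{|π|}(condE μ f B : B ∈ π)`) — with the counting weight on `Bool` as outer factor, `E^{counting}_k = 0` for `k ≥ 3`
kills all partitions with more than two blocks — and the layer law (★) below is also prim-l12-p5's "disjoint-support form" (memo
FROM-prim-l12-p5-g14-PUSHUP-LEMMA §3).  What this file adds: the statements for ARBITRARY layer weights in Finset sub-family form, the additivity law as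
such, the inequalities / iff's, and recursion-only proofs via `…SahiTangentLayerProduct`:
* §4 `sahiE_layers_eq` — THE LAW OF TOTAL `E_n` displayed in the title.  Proof: multilinear expansion `F_l = ε̄·g⁰_l + ε·g¹_l`
  (`sahiE_add_eq_sum_subsets`); the term `S = [n]` is top-only (`= E^{μ¹}(g¹)`, `sahiE_layers_top`), `S = ∅` bottom-only; a proper `S`
  gives a family that is top-only on `S` and bottom-only off `S`, whose mixed moments across `S | Sᶜ` vanish, so the product formula
  (`sahiE_eq_neg_mul_of_cross_moments`) gives `−E^{μ¹}(g¹|_S)·E^{μ⁰}(g⁰|_{Sᶜ})` (`sahiE_layers_split`).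
  COMPARISON with gen 51 (`…SahiTangentPairTwoWeights`, `sahiE_coin₂_pair_eq_sum`): that is the same quantity in the `(E¹−E⁰, E⁰)`
  basis, a sum over set partitions and block colourings with the nonnegative coefficients `ψ_{i,j}(s)`; here the coefficients are `±1`
  and every term is a product of AT MOST TWO functionals — one of pure top sections under `μ¹`, one of pure bottom sections under `μ⁰`;
  no mixed differences, no set partitions.  Consequences: `sahiE_layers_le` (UPPER bound `E_n^{ν}(F) ≤ E_n^{μ¹}(g¹) + E_n^{μ⁰}(g⁰)`
  when the proper sub-families of each layer are Sahi-nonnegative) and `sahiE_layers_nonneg_iff` (SAHI POSITIVITY ON `Bool × α`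
  ⟺ "the cross terms are dominated": `Σ_{∅≠S⊊[n]} E^{μ¹}(g¹|_S)E^{μ⁰}(g⁰|_{Sᶜ}) ≤ E_n^{μ¹}(g¹) + E_n^{μ⁰}(g⁰)` — a statement about
  functionals on `α` of pure sections only).
* §5 `sahiE_add_weight` — ADDITIVITY IN THE WEIGHT (gen 51 memo §5, there verified symbolically for `n ≤ 5`; now a theorem at every
  order): `E_n^{μ+ν}(f) = E_n^{μ}(f) + E_n^{ν}(f) − Σ_{∅≠S⊊[n]} E^{μ}(f|_S)·E^{ν}(f|_{Sᶜ})` (the layer law for `f ∘ snd`);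
  SUBADDITIVITY `sahiE_add_weight_le`; the COIN FORM `sahiE_coin_pair_eq_layers`
  (`E_n^{B_s⊗μ}(F) = E_n^{s·μ}(g¹) + E_n^{(1−s)·μ}(g⁰) − Σ E^{s·μ}(g¹|_S)E^{(1−s)·μ}(g⁰|_{Sᶜ})`, whose right side expands further in
  `μ`-functionals by gen 51's scaling theorem `sahiE_smul_weight_eq_sum`) and `sahiE_coin_pair_nonneg_iff`.
Exact pre-check outside Lean (seat `code/gen52/verify_layers.py`): 483 random instances `n ≤ 6`, 0 mismatches.
Nothing conjectural is asserted. [this work; mechanism: Sahi2008 eq. (3)/(14), Prop. 12]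
-/

namespace Summit.CriticalPhenomena.PercolationContinuityZ3.Theorems.SahiTangent

open Finset Function Literature.Combinatorics.Sahi2008
open scoped BigOperators

noncomputable section

variable {α : Type*} [Fintype α]

/-! ### §4 The law of total `E_n` on `Bool × α` in the `(E¹, E⁰)` basis -/

/-- Expectation under the two-layer weight: `E_ν(Φ) = E_{μ¹}(Φ(1,·)) + E_{μ⁰}(Φ(0,·))`. [folklore] -/
theorem ex_layers (μ₁ μ₀ : α → ℝ) (Φ : Bool × α → ℝ) :
    ex (fun z : Bool × α => if z.1 then μ₁ z.2 else μ₀ z.2) Φ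
      = ex μ₁ (fun x => Φ (true, x)) + ex μ₀ (fun x => Φ (false, x)) := by
  simp only [ex, Fintype.sum_prod_type, Fintype.sum_bool, if_true, Bool.false_eq_true, if_false]

/-- A TOP-ONLY family has the `E_n` of its top sections under the top weight. [this work] -/
theorem sahiE_layers_top (μ₁ μ₀ : α → ℝ) {p : ℕ} (h : Fin p → α → ℝ) :
    sahiE (fun z : Bool × α => if z.1 then μ₁ z.2 else μ₀ z.2) p
        (fun r (z : Bool × α) => if z.1 then h r z.2 else 0) = sahiE μ₁ p h := by
  refine sahiE_congr_of_moments _ _ p _ _ fun S hS => ?_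
  rw [ex_layers]
  have h1 : (fun x : α => (∏ i ∈ S, fun z : Bool × α => if z.1 then h i z.2 else (0 : ℝ)) (true, x))
      = ∏ i ∈ S, h i := by
    funext x; simp only [Finset.prod_apply, if_true]
  have h0 : (fun x : α => (∏ i ∈ S, fun z : Bool × α => if z.1 then h i z.2 else (0 : ℝ)) (false, x))
      = fun _ => 0 := by
    funext x
    obtain ⟨i, hi⟩ := hS
    rw [Finset.prod_apply]
    exact Finset.prod_eq_zero hi (by simp)
  rw [h1, h0]
  simp [ex]

/-- A BOTTOM-ONLY family has the `E_n` of its bottom sections under the bottom weight. [this work] -/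
theorem sahiE_layers_bot (μ₁ μ₀ : α → ℝ) {p : ℕ} (h : Fin p → α → ℝ) :
    sahiE (fun z : Bool × α => if z.1 then μ₁ z.2 else μ₀ z.2) p
        (fun r (z : Bool × α) => if z.1 then 0 else h r z.2) = sahiE μ₀ p h := by
  refine sahiE_congr_of_moments _ _ p _ _ fun S hS => ?_
  rw [ex_layers]
  have h0 : (fun x : α => (∏ i ∈ S, fun z : Bool × α => if z.1 then (0 : ℝ) else h i z.2) (false, x))
      = ∏ i ∈ S, h i := by
    funext x; simp only [Finset.prod_apply, Bool.false_eq_true, if_false]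
  have h1 : (fun x : α => (∏ i ∈ S, fun z : Bool × α => if z.1 then (0 : ℝ) else h i z.2) (true, x))
      = fun _ => 0 := by
    funext x
    obtain ⟨i, hi⟩ := hS
    rw [Finset.prod_apply]
    exact Finset.prod_eq_zero hi (by simp)
  rw [h1, h0]
  simp [ex]

/-- **Split families multiply (layer form).**  For a proper nonempty set of slots `S`, the family that is TOP-ONLY
(`ε·g¹_l`) on `S` and BOTTOM-ONLY (`ε̄·g⁰_l`) off `S` has, under any two-layer weight,
`E_n = −E_{|S|}^{μ¹}(g¹|_S) · E_{|Sᶜ|}^{μ⁰}(g⁰|_{Sᶜ})` — in particular it is `≤ 0` as soon as both factors are `≥ 0`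
("mutually exclusive groups are negatively Sahi-correlated, in product form"). [this work] -/
theorem sahiE_layers_split (μ₁ μ₀ : α → ℝ) {n : ℕ} (g₁ g₀ : Fin n → α → ℝ) (S : Finset (Fin n))
    (hS : S.Nonempty) (hS' : S ≠ univ) :
    sahiE (fun z : Bool × α => if z.1 then μ₁ z.2 else μ₀ z.2) n
        (fun l (z : Bool × α) => if l ∈ S then (if z.1 then g₁ l z.2 else 0) else (if z.1 then 0 else g₀ l z.2))
      = -(sahiE μ₁ S.card (fun j => g₁ (S.orderEmbOfFin rfl j))
          * sahiE μ₀ Sᶜ.card (fun j => g₀ (Sᶜ.orderEmbOfFin rfl j))) := by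
  classical
  have hSc : Sᶜ.Nonempty := by
    rw [Finset.nonempty_iff_ne_empty, Ne, Finset.compl_eq_empty_iff]; exact hS'
  -- `n ≥ 2`
  obtain ⟨m, rfl⟩ : ∃ m, n = m + 2 := by
    have h2 : 2 ≤ n := by
      have h := Finset.card_le_univ (S ∪ Sᶜ)
      have hc : (S ∪ Sᶜ).card = S.card + Sᶜ.card := Finset.card_union_of_disjoint disjoint_compl_right
      rw [Fintype.card_fin] at h
      have := hS.card_pos; have := hSc.card_pos; omega
    exact ⟨n - 2, by omega⟩
  set e₁ : Fin S.card → Fin (m + 2) := fun r => S.orderEmbOfFin rfl r with he₁_def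
  set e₂ : Fin Sᶜ.card → Fin (m + 2) := fun r => Sᶜ.orderEmbOfFin rfl r with he₂_def
  have hm₁ : ∀ r, e₁ r ∈ S := fun r => Finset.orderEmbOfFin_mem S rfl r
  have hm₂ : ∀ r, e₂ r ∈ Sᶜ := fun r => Finset.orderEmbOfFin_mem Sᶜ rfl r
  have hm₂' : ∀ r, e₂ r ∉ S := fun r => Finset.mem_compl.1 (hm₂ r)
  rw [sahiE_eq_neg_mul_of_cross_moments _ m S.card Sᶜ.card _ e₁ e₂ (S.orderEmbOfFin rfl).strictMono
    (Sᶜ.orderEmbOfFin rfl).strictMono hS.card_pos hSc.card_pos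
    (fun r r' h => hm₂' r' (h ▸ hm₁ r)) (fun i => ?_) (fun T h1 h2 => ?_)]
  · -- the two factors
    congr 2
    · have : (fun r (z : Bool × α) => if e₁ r ∈ S then (if z.1 then g₁ (e₁ r) z.2 else (0 : ℝ))
          else (if z.1 then 0 else g₀ (e₁ r) z.2)) = fun r (z : Bool × α) => if z.1 then g₁ (e₁ r) z.2 else 0 := by
        funext r z; rw [if_pos (hm₁ r)]
      rw [this, sahiE_layers_top]
    · have : (fun r (z : Bool × α) => if e₂ r ∈ S then (if z.1 then g₁ (e₂ r) z.2 else (0 : ℝ))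
          else (if z.1 then 0 else g₀ (e₂ r) z.2)) = fun r (z : Bool × α) => if z.1 then 0 else g₀ (e₂ r) z.2 := by
        funext r z; rw [if_neg (hm₂' r)]
      rw [this, sahiE_layers_bot]
  · -- the two groups cover
    by_cases hi : i ∈ S
    · left
      have h := Finset.range_orderEmbOfFin S rfl
      have : i ∈ Set.range (S.orderEmbOfFin rfl) := by rw [h]; exact hi
      obtain ⟨r, hr⟩ := this
      exact ⟨r, hr⟩
    · right
      have h := Finset.range_orderEmbOfFin Sᶜ rfl
      have : i ∈ Set.range (Sᶜ.orderEmbOfFin rfl) := by rw [h]; exact Finset.mem_compl.2 hi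
      obtain ⟨r, hr⟩ := this
      exact ⟨r, hr⟩
  · -- mixed moments vanish: on the top layer a bottom-only slot is `0`, on the bottom layer a top-only slot is `0`
    obtain ⟨r₁, hr₁⟩ := h1
    obtain ⟨r₂, hr₂⟩ := h2
    rw [ex_layers]
    have ht : (fun x : α => (∏ i ∈ T, fun z : Bool × α =>
        if i ∈ S then (if z.1 then g₁ i z.2 else (0 : ℝ)) else (if z.1 then 0 else g₀ i z.2)) (true, x)) = fun _ => 0 := by
      funext x
      rw [Finset.prod_apply]
      exact Finset.prod_eq_zero hr₂ (by rw [if_neg (hm₂' r₂), if_pos rfl])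
    have hf : (fun x : α => (∏ i ∈ T, fun z : Bool × α =>
        if i ∈ S then (if z.1 then g₁ i z.2 else (0 : ℝ)) else (if z.1 then 0 else g₀ i z.2)) (false, x)) = fun _ => 0 := by
      funext x
      rw [Finset.prod_apply]
      exact Finset.prod_eq_zero hr₁ (by rw [if_pos (hm₁ r₁)]; simp)
    rw [ht, hf]
    simp [ex]

/-- **THE LAW OF TOTAL `E_n` IN THE `(E¹, E⁰)` BASIS (all orders).**  For ANY two real weights `μ¹` (top layer), `μ⁰`
(bottom layer) on a finite type `α`, any `n` and any two families `g¹, g⁰ : Fin n → α → ℝ`, the pair family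
`F_l(ε,x) = ε ? g¹_l(x) : g⁰_l(x)` on `Bool × α` satisfies
`E_n^{ν}(F) = E_n^{μ¹}(g¹) + E_n^{μ⁰}(g⁰) − Σ_{∅ ≠ S ⊊ [n]} E_{|S|}^{μ¹}(g¹|_S) · E_{|Sᶜ|}^{μ⁰}(g⁰|_{Sᶜ})`.
Every term on the right is a functional of pure top sections or of pure bottom sections.  (`μ¹ = s·μ`, `μ⁰ = (1−s)·μ`: the
coin product `B_s ⊗ μ`, `sahiE_coin_pair_eq_layers`; conditional reading for a probability weight `ν` on `Bool × α`:
`μ¹ = ν(top)·ν(·|top)`, `μ⁰ = ν(bottom)·ν(·|bottom)`.) [this work; mechanism: Sahi2008 eq. (3)/(14)] -/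
theorem sahiE_layers_eq (μ₁ μ₀ : α → ℝ) {n : ℕ} (g₁ g₀ : Fin n → α → ℝ) :
    sahiE (fun z : Bool × α => if z.1 then μ₁ z.2 else μ₀ z.2) n
        (fun l (z : Bool × α) => if z.1 then g₁ l z.2 else g₀ l z.2)
      = sahiE μ₁ n g₁ + sahiE μ₀ n g₀
        - ∑ S : Finset (Fin n) with (S.Nonempty ∧ S ≠ univ),
            sahiE μ₁ S.card (fun j => g₁ (S.orderEmbOfFin rfl j))
              * sahiE μ₀ Sᶜ.card (fun j => g₀ (Sᶜ.orderEmbOfFin rfl j)) := by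
  classical
  rcases Nat.eq_zero_or_pos n with hn | hn
  · -- `n = 0`: everything vanishes
    subst hn
    have hsum : ∑ S : Finset (Fin 0) with (S.Nonempty ∧ S ≠ univ),
        sahiE μ₁ S.card (fun j => g₁ (S.orderEmbOfFin rfl j))
          * sahiE μ₀ Sᶜ.card (fun j => g₀ (Sᶜ.orderEmbOfFin rfl j)) = 0 := by
      refine Finset.sum_eq_zero fun S hS => ?_
      have h := (Finset.mem_filter.1 hS).2
      exact (h.2 (Subsingleton.elim S univ)).elim
    rw [hsum, sahiE_zero, sahiE_zero, sahiE_zero]; ring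
  -- `n ≥ 1`: multilinear expansion `F_l = ε̄·g⁰_l + ε·g¹_l`
  set W : Bool × α → ℝ := fun z => if z.1 then μ₁ z.2 else μ₀ z.2 with hW
  set T : Fin n → Bool × α → ℝ := fun l z => if z.1 then g₁ l z.2 else 0 with hT
  set B : Fin n → Bool × α → ℝ := fun l z => if z.1 then 0 else g₀ l z.2 with hB
  have hF : (fun l (z : Bool × α) => if z.1 then g₁ l z.2 else g₀ l z.2) = fun l => B l + T l := by
    funext l z
    simp only [hB, hT, Pi.add_apply]
    split_ifs <;> ring
  rw [hF, sahiE_add_eq_sum_subsets]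
  -- split off `S = univ` (top-only) and `S = ∅` (bottom-only)
  have hne : (univ : Finset (Fin n)) ≠ ∅ := by
    obtain ⟨m, rfl⟩ := Nat.exists_eq_add_one.2 hn
    exact Finset.univ_nonempty.ne_empty
  have hsplit : (univ : Finset (Finset (Fin n)))
      = {univ, ∅} ∪ (univ.filter fun S : Finset (Fin n) => S.Nonempty ∧ S ≠ univ) := by
    ext S
    simp only [Finset.mem_univ, Finset.mem_union, Finset.mem_insert, Finset.mem_singleton, Finset.mem_filter,
      true_and, true_iff]
    by_cases h1 : S = univ
    · exact Or.inl (Or.inl h1)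
    · by_cases h2 : S = ∅
      · exact Or.inl (Or.inr h2)
      · exact Or.inr ⟨Finset.nonempty_iff_ne_empty.2 h2, h1⟩
  have hdisj : Disjoint ({univ, ∅} : Finset (Finset (Fin n)))
      (univ.filter fun S : Finset (Fin n) => S.Nonempty ∧ S ≠ univ) := by
    rw [Finset.disjoint_left]
    intro S hS hS'
    simp only [Finset.mem_insert, Finset.mem_singleton] at hS
    have h := (Finset.mem_filter.1 hS').2
    rcases hS with rfl | rfl
    · exact h.2 rfl
    · exact Finset.not_nonempty_empty h.1
  have hsum3 : (∑ S : Finset (Fin n), sahiE W n (fun l => if l ∈ S then T l else B l))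
      = sahiE W n (fun l => if l ∈ (univ : Finset (Fin n)) then T l else B l)
        + sahiE W n (fun l => if l ∈ (∅ : Finset (Fin n)) then T l else B l)
        + ∑ S ∈ (univ.filter fun S : Finset (Fin n) => S.Nonempty ∧ S ≠ univ),
            sahiE W n (fun l => if l ∈ S then T l else B l) := by
    have : (∑ S : Finset (Fin n), sahiE W n (fun l => if l ∈ S then T l else B l))
        = ∑ S ∈ ({univ, ∅} ∪ (univ.filter fun S : Finset (Fin n) => S.Nonempty ∧ S ≠ univ)),
            sahiE W n (fun l => if l ∈ S then T l else B l) := by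
      rw [← hsplit]
    rw [this, Finset.sum_union hdisj, Finset.sum_pair hne]
  rw [hsum3]
  -- identify the three pieces
  have htop : sahiE W n (fun l => if l ∈ (univ : Finset (Fin n)) then T l else B l) = sahiE μ₁ n g₁ := by
    simp only [Finset.mem_univ, if_true]
    exact sahiE_layers_top μ₁ μ₀ g₁
  have hbot : sahiE W n (fun l => if l ∈ (∅ : Finset (Fin n)) then T l else B l) = sahiE μ₀ n g₀ := by
    simp only [Finset.notMem_empty, if_false]
    exact sahiE_layers_bot μ₁ μ₀ g₀
  rw [htop, hbot, sub_eq_add_neg, ← Finset.sum_neg_distrib]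
  congr 1
  refine Finset.sum_congr rfl fun S hS => ?_
  have h := (Finset.mem_filter.1 hS).2
  rw [← sahiE_layers_split μ₁ μ₀ g₁ g₀ S h.1 h.2]
  congr 1
  funext l z
  by_cases hl : l ∈ S <;> by_cases hz : z.1 = true <;> simp [hT, hB, hl, hz]

/-- **Upper bound by the pure layers.**  If the proper sub-families of the top sections are Sahi-nonnegative under `μ¹` and
those of the bottom sections under `μ⁰`, then `E_n^{ν}(F) ≤ E_n^{μ¹}(g¹) + E_n^{μ⁰}(g⁰)`. [this work] -/
theorem sahiE_layers_le (μ₁ μ₀ : α → ℝ) {n : ℕ} (g₁ g₀ : Fin n → α → ℝ)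
    (h₁ : ∀ S : Finset (Fin n), S.Nonempty → S ≠ univ → 0 ≤ sahiE μ₁ S.card (fun j => g₁ (S.orderEmbOfFin rfl j)))
    (h₀ : ∀ S : Finset (Fin n), S.Nonempty → S ≠ univ → 0 ≤ sahiE μ₀ S.card (fun j => g₀ (S.orderEmbOfFin rfl j))) :
    sahiE (fun z : Bool × α => if z.1 then μ₁ z.2 else μ₀ z.2) n
        (fun l (z : Bool × α) => if z.1 then g₁ l z.2 else g₀ l z.2)
      ≤ sahiE μ₁ n g₁ + sahiE μ₀ n g₀ := by
  classical
  rw [sahiE_layers_eq]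
  refine sub_le_self _ (Finset.sum_nonneg fun S hS => ?_)
  have h := (Finset.mem_filter.1 hS).2
  have hc1 : Sᶜ.Nonempty := by
    rw [Finset.nonempty_iff_ne_empty, Ne, Finset.compl_eq_empty_iff]; exact h.2
  have hc2 : Sᶜ ≠ univ := by
    rw [Ne, Finset.compl_eq_univ_iff]; exact h.1.ne_empty
  exact mul_nonneg (h₁ S h.1 h.2) (h₀ Sᶜ hc1 hc2)

/-- **Sahi positivity on `Bool × α`, reformulated**: `E_n^{ν}(F) ≥ 0` iff the cross terms are dominated by the pure layers,
`Σ_{∅≠S⊊[n]} E^{μ¹}(g¹|_S)·E^{μ⁰}(g⁰|_{Sᶜ}) ≤ E_n^{μ¹}(g¹) + E_n^{μ⁰}(g⁰)`. [this work] -/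
theorem sahiE_layers_nonneg_iff (μ₁ μ₀ : α → ℝ) {n : ℕ} (g₁ g₀ : Fin n → α → ℝ) :
    0 ≤ sahiE (fun z : Bool × α => if z.1 then μ₁ z.2 else μ₀ z.2) n
        (fun l (z : Bool × α) => if z.1 then g₁ l z.2 else g₀ l z.2)
      ↔ ∑ S : Finset (Fin n) with (S.Nonempty ∧ S ≠ univ),
            sahiE μ₁ S.card (fun j => g₁ (S.orderEmbOfFin rfl j))
              * sahiE μ₀ Sᶜ.card (fun j => g₀ (Sᶜ.orderEmbOfFin rfl j))
          ≤ sahiE μ₁ n g₁ + sahiE μ₀ n g₀ := by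
  rw [sahiE_layers_eq, sub_nonneg]

/-! ### §5 Additivity of `E_n` in the weight; the coin form -/

/-- Expectation is additive in the weight. [folklore] -/
theorem ex_add_weight (μ ν : α → ℝ) (g : α → ℝ) : ex (μ + ν) g = ex μ g + ex ν g := by
  simp only [ex, Pi.add_apply, add_mul, Finset.sum_add_distrib]

/-- **ADDITIVITY OF SAHI'S `E_n` IN THE WEIGHT (all orders).**  For ANY two real weights `μ, ν` on a finite type, any `n`
and any family `f`:
`E_n^{μ+ν}(f) = E_n^{μ}(f) + E_n^{ν}(f) − Σ_{∅ ≠ S ⊊ [n]} E_{|S|}^{μ}(f|_S) · E_{|Sᶜ|}^{ν}(f|_{Sᶜ})`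
("`1 − G` is multiplicative in the weight", [Sahi2008, eq. (14)], polarised; e.g. `n = 2`:
`Cov_{μ+ν}(f,g) = Cov_μ + Cov_ν − E_μ f·E_ν g − E_ν f·E_μ g` for unnormalised weights).  Proof: the law of total `E_n` for the
family `f ∘ snd` on `Bool × α` with layers `μ, ν`, whose moments are those of `f` under `μ + ν`. [this work] -/
theorem sahiE_add_weight (μ ν : α → ℝ) {n : ℕ} (f : Fin n → α → ℝ) :
    sahiE (μ + ν) n f = sahiE μ n f + sahiE ν n f
        - ∑ S : Finset (Fin n) with (S.Nonempty ∧ S ≠ univ),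
            sahiE μ S.card (fun j => f (S.orderEmbOfFin rfl j))
              * sahiE ν Sᶜ.card (fun j => f (Sᶜ.orderEmbOfFin rfl j)) := by
  rw [← sahiE_layers_eq μ ν f f]
  refine sahiE_congr_of_moments _ _ n _ _ fun S _ => ?_
  rw [ex_add_weight, ex_layers]
  have h : ∀ b : Bool, (fun x : α => (∏ i ∈ S, fun z : Bool × α => if z.1 then f i z.2 else f i z.2) (b, x))
      = ∏ i ∈ S, f i := by
    intro b; funext x
    rw [Finset.prod_apply, Finset.prod_apply]
    exact Finset.prod_congr rfl fun i _ => by cases b <;> rfl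
  rw [h true, h false]

/-- **Subadditivity in the weight.**  If the proper sub-families of `f` are Sahi-nonnegative under `μ` and under `ν`, then
`E_n^{μ+ν}(f) ≤ E_n^{μ}(f) + E_n^{ν}(f)`. [this work] -/
theorem sahiE_add_weight_le (μ ν : α → ℝ) {n : ℕ} (f : Fin n → α → ℝ)
    (hμ : ∀ S : Finset (Fin n), S.Nonempty → S ≠ univ → 0 ≤ sahiE μ S.card (fun j => f (S.orderEmbOfFin rfl j)))
    (hν : ∀ S : Finset (Fin n), S.Nonempty → S ≠ univ → 0 ≤ sahiE ν S.card (fun j => f (S.orderEmbOfFin rfl j))) :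
    sahiE (μ + ν) n f ≤ sahiE μ n f + sahiE ν n f := by
  classical
  rw [sahiE_add_weight]
  refine sub_le_self _ (Finset.sum_nonneg fun S hS => ?_)
  have h := (Finset.mem_filter.1 hS).2
  have hc1 : Sᶜ.Nonempty := by
    rw [Finset.nonempty_iff_ne_empty, Ne, Finset.compl_eq_empty_iff]; exact h.2
  have hc2 : Sᶜ ≠ univ := by
    rw [Ne, Finset.compl_eq_univ_iff]; exact h.1.ne_empty
  exact mul_nonneg (hμ S h.1 h.2) (hν Sᶜ hc1 hc2)

/-- **The coin form** (the setting of Conjecture `T_n` and of the `…SahiTangent*` files): for the coin product `B_s ⊗ μ` on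
`Bool × α` and ANY pair family with top sections `g¹` and bottom sections `g⁰`,
`E_n^{B_s⊗μ}(F) = E_n^{s·μ}(g¹) + E_n^{(1−s)·μ}(g⁰) − Σ_{∅≠S⊊[n]} E^{s·μ}(g¹|_S)·E^{(1−s)·μ}(g⁰|_{Sᶜ})`
(any real `s`; the scaled functionals expand in products of `μ`-functionals by `sahiE_smul_weight_eq_sum`). [this work] -/
theorem sahiE_coin_pair_eq_layers (μ : α → ℝ) (s : ℝ) {n : ℕ} (g₁ g₀ : Fin n → α → ℝ) :
    sahiE (fun z : Bool × α => if z.1 then s * μ z.2 else (1 - s) * μ z.2) n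
        (fun l (z : Bool × α) => if z.1 then g₁ l z.2 else g₀ l z.2)
      = sahiE (s • μ) n g₁ + sahiE ((1 - s) • μ) n g₀
        - ∑ S : Finset (Fin n) with (S.Nonempty ∧ S ≠ univ),
            sahiE (s • μ) S.card (fun j => g₁ (S.orderEmbOfFin rfl j))
              * sahiE ((1 - s) • μ) Sᶜ.card (fun j => g₀ (Sᶜ.orderEmbOfFin rfl j)) := by
  rw [show (fun z : Bool × α => if z.1 then s * μ z.2 else (1 - s) * μ z.2)
      = (fun z : Bool × α => if z.1 then (s • μ) z.2 else ((1 - s) • μ) z.2) from by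
    funext z; simp only [Pi.smul_apply, smul_eq_mul]]
  exact sahiE_layers_eq _ _ g₁ g₀

/-- **Sahi positivity on the coin space, reformulated**: `0 ≤ E_n^{B_s⊗μ}(F)` iff
`Σ_{∅≠S⊊[n]} E^{s·μ}(g¹|_S)·E^{(1−s)·μ}(g⁰|_{Sᶜ}) ≤ E_n^{s·μ}(g¹) + E_n^{(1−s)·μ}(g⁰)` — a statement about functionals
on `α` of the pure top sections and the pure bottom sections only. [this work] -/
theorem sahiE_coin_pair_nonneg_iff (μ : α → ℝ) (s : ℝ) {n : ℕ} (g₁ g₀ : Fin n → α → ℝ) :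
    0 ≤ sahiE (fun z : Bool × α => if z.1 then s * μ z.2 else (1 - s) * μ z.2) n
        (fun l (z : Bool × α) => if z.1 then g₁ l z.2 else g₀ l z.2)
      ↔ ∑ S : Finset (Fin n) with (S.Nonempty ∧ S ≠ univ),
            sahiE (s • μ) S.card (fun j => g₁ (S.orderEmbOfFin rfl j))
              * sahiE ((1 - s) • μ) Sᶜ.card (fun j => g₀ (Sᶜ.orderEmbOfFin rfl j))
          ≤ sahiE (s • μ) n g₁ + sahiE ((1 - s) • μ) n g₀ := by
  rw [sahiE_coin_pair_eq_layers, sub_nonneg]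

end

end Summit.CriticalPhenomena.PercolationContinuityZ3.Theorems.SahiTangent
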